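import Summits.QuantumFields.YangMills.Theorems.BalabanUVNodesPortS1JacobianLocal
import Summits.QuantumFields.YangMills.Theorems.BalabanUVNodesPortS1HalvesDefs

/-!
# NODE O port PT-A — `Φ₁ = phiLZ` IN ITS TWO PRINT PIECES: under the letters (the `b₀`-block invertible and the preconditioned matrix positive definite at `W_B` and at `W_0`),
# `phiLZ n B = −½[log det T(B) − log det T(0)] − [log|det A₁(B)| − log|det A₁(0)|]`, `T = recordPreckLoc` (the `T` of `B10LogDet63.matrix63`, [16] (63)), `A₁ = recordLQtB0` (the (1.4)
# δ-Jacobian), and the second bracket is a SUM OVER COARSE BONDS of single-bond terms (`…PortS1JacobianLocal.log_abs_det_recordLQtB0_eq_sum`) — LZ-SPEC-v1 (R-a) AT THE NAMES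

Cell `ym-nodeO-ideate`, porter seat `ymgap-nodeO-port-PTA-1` (gen 4); `--supports stmt-QuantumFields-27930` (helper; first algebraic step of the registered stub `stub_LZ : ∀ F, PortRecordLZHalf F` of
`Cruxes/PortRecordRepresentationS1/Lines/pta_residueW.lean`).  [I] = [Balaban1987RG1], [16] = [Balaban1985UV3].
* §1 `recordLogZkkLoc_eq` — `log Z_loc = −log|det A₁| + (#NonB0Idx)·(log 2π)∕2 − ½·log det T` (`B12Eq15QuadraticForm.logZ14_eq`).
* §2 ★ `phiLZ_eq_logDet` — the two-bracket form of `phiLZ` (the volume constant cancels); ★★ `phiLZ_eq_logDet_sum` — with the δ-Jacobian bracket as `Σ_c` of single-coarse-bond terms.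
What remains for `stub_LZ` after this file: the walk localisation of `log det T(B) − log det T(0)` ([16] (63): `B10LogDet63.matrix63` ∕ `B10Eq63Rep` at `T := recordPreckLoc`, leaves (P)(Γ₁)(α)(β)(γ) +
(R-c) at the record) and rows (a)(b) for both brackets on the COMPLEX record space (holomorphic extensions of the carriers) — NODE O content, displayed nowhere here.

HONEST FRAMING.  Algebra of logarithms at the record's names under displayed letters; NOTHING of Bałaban asserted, ported or discharged; `stub_LZ` NOT proved; 27930 OPEN; K0⁷∕K-Ax OPEN;
NODE O 0∕1; COUNT 8∕28 · K 1∕4 UNMOVED; finite `𝕋⁴_{L^K}` at fixed ε — NOT continuum ∕ OS ∕ Clay; **the Yang–Mills mass gap is NOT proved by any of this.**  No `sorry`, no `def`, no `instance`.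
-/

noncomputable section

open scoped BigOperators Matrix.Norms.L2Operator Topology

namespace Summit.QuantumFields.YangMills.Theorems.BalabanUVNodesPortS1

open Summit.QuantumFields.YangMills.Theorems.K0RecordFormatNames
open Literature.MathematicalPhysics.QuantumFieldTheory.Balaban1983to89
open Literature.MathematicalPhysics.QuantumFieldTheory.Balaban1983to89.Node00
open Literature.MathematicalPhysics.QuantumFieldTheory.Balaban1983to89.T4Continuum (T4Family)
open _root_.Matrix

variable (F : T4Family)

/-! ## §1  `log Z_loc` in closed form -/

open Classical in
/-- **`log Z^{(k)}_loc = −log|det A₁| + (#NonB0Idx)·(log 2π)∕2 − ½ log det T`** for the graph-coordinate Gaussian `recordZkkLoc = |det A₁|⁻¹ · Z14 Sk_blk C_loc` with `T = C_locᵀ Sk_blk C_loc =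
recordPreckLoc` positive definite and the letter `RecordB0BlockInvertible` (closed Gaussian form `B12Eq15QuadraticForm.logZ14_eq`). [cite: Balaban1987RG1, (1.3)–(1.4) p.260, p.268] -/
theorem recordLogZkkLoc_eq (k K : ℕ) (εbg : ℝ) (Vk : GaugeField (F.P K) k (SU 2)) (hopLin : (PBond (F.P K) (k + 1) → MatA 2) →ₗ[ℝ] (FluctIdx F k K → ℝ))
    (hA : RecordB0BlockInvertible F k K Vk) (hP : (recordPreckLoc F k K εbg Vk hopLin).PosDef) :
    recordLogZkkLoc F k K εbg Vk hopLin =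
      -Real.log |(recordLQtB0 F k K Vk).det| + (Fintype.card (NonB0Idx F k K) : ℝ) * (Real.log (2 * Real.pi) / 2)
        - Real.log (recordPreckLoc F k K εbg Vk hopLin).det / 2 := by
  have hP' : ((recordCopLoc F k K Vk)ᵀ * recordSkBlk F k K εbg Vk hopLin * recordCopLoc F k K Vk).PosDef := hP
  have hZ := B12Eq15QuadraticForm.logZ14_eq (recordSkBlk F k K εbg Vk hopLin) (recordCopLoc F k K Vk) hP'
  rw [B12Eq15QuadraticForm.logZ14] at hZ
  have hZpos : 0 < B12Eq15QuadraticForm.Z14 (recordSkBlk F k K εbg Vk hopLin) (recordCopLoc F k K Vk) := B12Eq15QuadraticForm.Z14_pos _ _ hP'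
  have hA0 : |(recordLQtB0 F k K Vk).det| ≠ 0 := abs_ne_zero.mpr hA.ne_zero
  have hT : recordPreckLoc F k K εbg Vk hopLin = (recordCopLoc F k K Vk)ᵀ * recordSkBlk F k K εbg Vk hopLin * recordCopLoc F k K Vk := rfl
  rw [recordLogZkkLoc, recordZkkLoc, Real.log_mul (inv_ne_zero hA0) hZpos.ne', Real.log_inv, hZ, hT]
  ring

/-! ## §2  `phiLZ` in its two print pieces -/

open Classical in
/-- ★ **`Φ₁` IN TWO BRACKETS**: under the letters at `W_B` and at `W_0` (the `b₀`-blocks invertible, the preconditioned matrices positive definite),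
`phiLZ n B = −½[log det T(B) − log det T(0)] − [log|det A₁(B)| − log|det A₁(0)|]` — `T(·) = recordPreckLoc` at `V^{(k)}_{ax}(W_·)` with the porter's `h`, `A₁(·) = recordLQtB0` there; the
volume constant `(#NonB0Idx)·(log 2π)∕2` cancels. [cite: Balaban1987RG1, (2.12) p.268, (1.3)–(1.4) p.260; Balaban1985UV3, (61)–(63) p.272] -/
theorem phiLZ_eq_logDet (Mc : ℕ) (a₀ ε₂₉ : ℝ) (k n : ℕ) (B : recordW F a₀ ε₂₉ k (recordK₀ F Mc k + n))
    (hA : RecordB0BlockInvertible F k (recordK₀ F Mc k + n) (portVkAx F a₀ ε₂₉ k (recordK₀ F Mc k + n) B))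
    (hA₀ : letI θ := thetaFill F a₀ ε₂₉; letI := θ.instVβ₁; letI := θ.instVβ₂;
      RecordB0BlockInvertible F k (recordK₀ F Mc k + n) (portVkAx F a₀ ε₂₉ k (recordK₀ F Mc k + n) 0))
    (hP : (recordPreckLoc F k (recordK₀ F Mc k + n) (thetaFill F a₀ ε₂₉).εbg (portVkAx F a₀ ε₂₉ k (recordK₀ F Mc k + n) B)
      (hopLinGraph F k (recordK₀ F Mc k + n) (portVkAx F a₀ ε₂₉ k (recordK₀ F Mc k + n) B))).PosDef)
    (hP₀ : letI θ := thetaFill F a₀ ε₂₉; letI := θ.instVβ₁; letI := θ.instVβ₂;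
      (recordPreckLoc F k (recordK₀ F Mc k + n) (thetaFill F a₀ ε₂₉).εbg (portVkAx F a₀ ε₂₉ k (recordK₀ F Mc k + n) 0)
        (hopLinGraph F k (recordK₀ F Mc k + n) (portVkAx F a₀ ε₂₉ k (recordK₀ F Mc k + n) 0))).PosDef) :
    letI θ := thetaFill F a₀ ε₂₉; letI := θ.instVβ₁; letI := θ.instVβ₂;
    phiLZ F Mc a₀ ε₂₉ k n B =
      ((-(1 / 2 : ℝ) * (Real.log (recordPreckLoc F k (recordK₀ F Mc k + n) (thetaFill F a₀ ε₂₉).εbg (portVkAx F a₀ ε₂₉ k (recordK₀ F Mc k + n) B)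
            (hopLinGraph F k (recordK₀ F Mc k + n) (portVkAx F a₀ ε₂₉ k (recordK₀ F Mc k + n) B))).det
          - Real.log (recordPreckLoc F k (recordK₀ F Mc k + n) (thetaFill F a₀ ε₂₉).εbg (portVkAx F a₀ ε₂₉ k (recordK₀ F Mc k + n) 0)
            (hopLinGraph F k (recordK₀ F Mc k + n) (portVkAx F a₀ ε₂₉ k (recordK₀ F Mc k + n) 0))).det)
        - (Real.log |(recordLQtB0 F k (recordK₀ F Mc k + n) (portVkAx F a₀ ε₂₉ k (recordK₀ F Mc k + n) B)).det|
          - Real.log |(recordLQtB0 F k (recordK₀ F Mc k + n) (portVkAx F a₀ ε₂₉ k (recordK₀ F Mc k + n) 0)).det|) : ℝ) : ℂ) := by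
  simp only [phiLZ, portLogZLocAt]
  rw [recordLogZkkLoc_eq F k _ _ _ _ hA hP, recordLogZkkLoc_eq F k _ _ _ _ hA₀ hP₀]
  push_cast
  ring

open Classical in
/-- ★★ **`Φ₁` IN TWO BRACKETS, THE δ-JACOBIAN BRACKET AS A SUM OF SINGLE-COARSE-BOND TERMS** (standing range `k + 1 ≤ m + K`, automatic at the texts' volumes):
`phiLZ n B = −½[log det T(B) − log det T(0)] − Σ_c [log|det A₁(c)(B)| − log|det A₁(c)(0)|]`. [cite: Balaban1987RG1, (2.12) p.268, (1.4) p.260, (1.6)–(1.7) p.261, p.267] -/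
theorem phiLZ_eq_logDet_sum (Mc : ℕ) (a₀ ε₂₉ : ℝ) (k n : ℕ) (B : recordW F a₀ ε₂₉ k (recordK₀ F Mc k + n))
    (hA : RecordB0BlockInvertible F k (recordK₀ F Mc k + n) (portVkAx F a₀ ε₂₉ k (recordK₀ F Mc k + n) B))
    (hA₀ : letI θ := thetaFill F a₀ ε₂₉; letI := θ.instVβ₁; letI := θ.instVβ₂;
      RecordB0BlockInvertible F k (recordK₀ F Mc k + n) (portVkAx F a₀ ε₂₉ k (recordK₀ F Mc k + n) 0))
    (hP : (recordPreckLoc F k (recordK₀ F Mc k + n) (thetaFill F a₀ ε₂₉).εbg (portVkAx F a₀ ε₂₉ k (recordK₀ F Mc k + n) B)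
      (hopLinGraph F k (recordK₀ F Mc k + n) (portVkAx F a₀ ε₂₉ k (recordK₀ F Mc k + n) B))).PosDef)
    (hP₀ : letI θ := thetaFill F a₀ ε₂₉; letI := θ.instVβ₁; letI := θ.instVβ₂;
      (recordPreckLoc F k (recordK₀ F Mc k + n) (thetaFill F a₀ ε₂₉).εbg (portVkAx F a₀ ε₂₉ k (recordK₀ F Mc k + n) 0)
        (hopLinGraph F k (recordK₀ F Mc k + n) (portVkAx F a₀ ε₂₉ k (recordK₀ F Mc k + n) 0))).PosDef) :
    letI θ := thetaFill F a₀ ε₂₉; letI := θ.instVβ₁; letI := θ.instVβ₂;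
    phiLZ F Mc a₀ ε₂₉ k n B =
      ((-(1 / 2 : ℝ) * (Real.log (recordPreckLoc F k (recordK₀ F Mc k + n) (thetaFill F a₀ ε₂₉).εbg (portVkAx F a₀ ε₂₉ k (recordK₀ F Mc k + n) B)
            (hopLinGraph F k (recordK₀ F Mc k + n) (portVkAx F a₀ ε₂₉ k (recordK₀ F Mc k + n) B))).det
          - Real.log (recordPreckLoc F k (recordK₀ F Mc k + n) (thetaFill F a₀ ε₂₉).εbg (portVkAx F a₀ ε₂₉ k (recordK₀ F Mc k + n) 0)
            (hopLinGraph F k (recordK₀ F Mc k + n) (portVkAx F a₀ ε₂₉ k (recordK₀ F Mc k + n) 0))).det)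
        - ∑ c : PBond (F.P (recordK₀ F Mc k + n)) (k + 1),
            (Real.log |(Matrix.of fun j j' : Fin 3 => recordLQtB0 F k (recordK₀ F Mc k + n) (portVkAx F a₀ ε₂₉ k (recordK₀ F Mc k + n) B) (c, j) (c, j')).det|
              - Real.log |(Matrix.of fun j j' : Fin 3 => recordLQtB0 F k (recordK₀ F Mc k + n) (portVkAx F a₀ ε₂₉ k (recordK₀ F Mc k + n) 0) (c, j) (c, j')).det|) : ℝ) : ℂ) := by
  have hk : k + 1 ≤ (F.P (recordK₀ F Mc k + n)).m + (F.P (recordK₀ F Mc k + n)).K := by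
    have hK : (F.P (recordK₀ F Mc k + n)).K = recordK₀ F Mc k + n := F.P_K _
    rw [hK, recordK₀]
    omega
  have h := phiLZ_eq_logDet F Mc a₀ ε₂₉ k n B hA hA₀ hP hP₀
  rw [log_abs_det_recordLQtB0_eq_sum F k _ hk _ hA, log_abs_det_recordLQtB0_eq_sum F k _ hk _ hA₀, ← Finset.sum_sub_distrib] at h
  exact h

end Summit.QuantumFields.YangMills.Theorems.BalabanUVNodesPortS1

end
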